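import Literature.Analysis.FluidPDE.WeakGradientWeakLimit
import HarnessLib

/-!
# Weak spatial gradients of limits: the extraction with full weak `L²` convergence of the gradients

Analysis/FluidPDE theorem file (no definitions, no named facts), a strengthening of the accepted
`exists_hasWeakSpatialGradientOn_of_weakGradient_approx` (`WeakGradientWeakLimit.lean`). There the
weak convergence of the extracted gradients `G_{κ k} ⇀ G` was exported only *tested against
space–time test functions*; the stability theorem for suitable weak solutions
(`isSuitableWeakSolutionOn_of_tendsto`, `SuitableWeakStability.lean`, hypothesis `hGw`) consumes it
in the full form "`G_{κ k} a ⇀ G a` weakly in `L²(Ω; E)` for every direction `a`", i.e. tested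
against **every** `h ∈ L²(Ω; E)`. Since the extraction is a weak limit in the Hilbert space
`L²(Ω; E^d)` this is native to the proof: `exists_hasWeakSpatialGradientOn_of_weakGradient_approx_L2`
re-runs it and exports, along one subsequence `κ`,

* the weak spatial gradient `G` of the limit field `u` on `Ω`, with `G ∈ L²(Ω)` and
  `∫∫_Ω |G|² ≤ L`;
* `∫_Ω ⟪G_{κ k} a, h⟫ → ∫_Ω ⟪G a, h⟫` for all `a ∈ E` and all `h ∈ L²(Ω; E)`;
* the tested form and the lower semicontinuity of the weighted dissipations
  `∫_Ω ψ |G|² ≤ lim inf_k ∫_Ω ψ |G_{κ k}|²` (as before).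

This is the gradient input of the compactness of suitable weak solutions on a cylinder
(Caffarelli–Kohn–Nirenberg 1982, §2; Lin 1998, Thm. 2.2; Bradshaw–Tsai 2019, §4.3: "`vₖ`
converges to `v` … in the weak topology on `L²(0,T;H¹(B₁))`"), cf. the named fact
`bradshawTsai2019_cylinderCompactness`.

Pointwise algebra used: `⟪T a, y⟫ = ⟪(T bᵢ)ᵢ, (⟪bᵢ, a⟫ y)ᵢ⟫_{E^d}` for an operator `T` and the
standard orthonormal frame `b` (`inner_apply_eq_inner_toLp_basis`,
`inner_tupleToCLM_const_apply_eq`), so that `∫_Ω ⟪Gₙ a, h⟫` is the `L²(Ω; E^d)` pairing of the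
gradient tuple of `Gₙ` with the direction tuple field `(⟪bᵢ, a⟫ h)ᵢ ∈ L²`.

## References

* H. Brezis, *Functional Analysis, Sobolev Spaces and PDE* (2011), Thm. 3.18, Prop. 3.5 (iii).
  [Brezis2011]
* L. Caffarelli, R. Kohn, L. Nirenberg, CPAM 35 (1982), §2, (2.1), (2.5). [CaffarelliKohnNirenberg1982]
* Z. Bradshaw, T.-P. Tsai, Analysis & PDE 12 (2019) = arXiv:1801.08060, §4.3. [BradshawTsai2019]
-/

noncomputable section

open MeasureTheory TopologicalSpace Set Function Filter Metric
open scoped RealInnerProductSpace ENNReal NNReal Topology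

namespace Literature.Analysis.FluidPDE

variable {E : Type*} [NormedAddCommGroup E] [InnerProductSpace ℝ E] [FiniteDimensional ℝ E]
  [MeasurableSpace E] [BorelSpace E]

/-! ### Direction tuples -/

section DirTuple

omit [MeasurableSpace E] [BorelSpace E] in
/-- **Pairing an operator in a direction through the frame**: for `T : E →L E` and `a, y ∈ E`,
`⟪T a, y⟫ = ⟪(T bᵢ)ᵢ, (⟪bᵢ, a⟫ y)ᵢ⟫` in `E^d` with the `ℓ²` inner product (expand
`a = Σᵢ ⟪bᵢ, a⟫ bᵢ` in the standard orthonormal frame). [folklore] -/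
theorem inner_apply_eq_inner_toLp_basis (T : E →L[ℝ] E) (a y : E) :
    ⟪T a, y⟫ = ⟪(WithLp.toLp 2 fun i => T (stdOrthonormalBasis ℝ E i) : GradTuple E),
      (WithLp.toLp 2 fun i => ⟪stdOrthonormalBasis ℝ E i, a⟫ • y : GradTuple E)⟫ := by
  conv_lhs => rw [← (stdOrthonormalBasis ℝ E).sum_repr' a]
  rw [map_sum, sum_inner, PiLp.inner_apply]
  refine Finset.sum_congr rfl fun i _ => ?_
  simp only [map_smul, real_inner_smul_left, real_inner_smul_right]

omit [MeasurableSpace E] [BorelSpace E] in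
/-- The same pairing for the operator assembled from a constant tuple `γ`:
`⟪tupleToCLM γ a, y⟫ = ⟪γ, (⟪bᵢ, a⟫ y)ᵢ⟫`. [folklore] -/
theorem inner_tupleToCLM_const_apply_eq (γ : GradTuple E) (a y : E) :
    ⟪tupleToCLM (fun _ : E => γ) 0 a, y⟫ =
      ⟪γ, (WithLp.toLp 2 fun i => ⟪stdOrthonormalBasis ℝ E i, a⟫ • y : GradTuple E)⟫ := by
  rw [tupleToCLM_apply, sum_inner, PiLp.inner_apply]
  refine Finset.sum_congr rfl fun i _ => ?_
  simp only [real_inner_smul_left, real_inner_smul_right]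

omit [MeasurableSpace E] [BorelSpace E] in
/-- The direction tuple map `y ↦ (⟪bᵢ, a⟫ y)ᵢ` is (the coercion of) a continuous linear map
`E →L E^d`. [folklore] -/
theorem exists_clm_dirTuple (a : E) :
    ∃ Lm : E →L[ℝ] GradTuple E, ∀ y,
      Lm y = (WithLp.toLp 2 fun i => ⟪stdOrthonormalBasis ℝ E i, a⟫ • y : GradTuple E) :=
  ⟨((PiLp.continuousLinearEquiv 2 ℝ (fun _ : Fin (Module.finrank ℝ E) => E)).symm :
      (Fin (Module.finrank ℝ E) → E) →L[ℝ] GradTuple E).comp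
    (ContinuousLinearMap.pi fun i => ⟪stdOrthonormalBasis ℝ E i, a⟫ • ContinuousLinearMap.id ℝ E),
    fun y => by
      ext i
      simp⟩

omit [MeasurableSpace E] [BorelSpace E] in
/-- **Direction tuple fields of `L²` fields are `L²`**: for `h ∈ L²(μ; E)` the tuple field
`z ↦ (⟪bᵢ, a⟫ h z)ᵢ` is in `L²(μ; E^d)`. [folklore] -/
theorem memLp_dirTuple {X : Type*} [MeasurableSpace X] {μ : Measure X} (a : E) {h : X → E}
    (hh : MemLp h 2 μ) :
    MemLp (fun z => (WithLp.toLp 2 fun i => ⟪stdOrthonormalBasis ℝ E i, a⟫ • h z : GradTuple E))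
      2 μ := by
  obtain ⟨Lm, hLm⟩ := exists_clm_dirTuple (E := E) a
  have h1 := ContinuousLinearMap.comp_memLp' Lm hh
  have e : (Lm ∘ h) = fun z =>
      (WithLp.toLp 2 fun i => ⟪stdOrthonormalBasis ℝ E i, a⟫ • h z : GradTuple E) :=
    funext fun z => hLm (h z)
  rwa [e] at h1

end DirTuple

/-! ### The extraction theorem, `L²` form -/

section Extraction

set_option maxHeartbeats 800000 in
/-- **Weak spatial gradients of limits of fields with weak spatial gradients: extraction with full
weak `L²` convergence of the gradients.** Let `Ω ⊆ ℝ × E` be open, `u` locally integrable on `Ω`,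
`Vₙ` fields with weak spatial gradients `Gₙ` on `Ω` of dissipation `∫∫_Ω |Gₙ|² ≤ L < ∞`, and
`Vₙ → u` in `L¹(K)` for every compact `K ⊆ Ω`. Then along a subsequence `κ`: `u` has a weak
spatial gradient `G ∈ L²(Ω)` on `Ω` with `∫∫_Ω |G|² ≤ L`; **`∫_Ω ⟪G_{κ k} a, h⟫ → ∫_Ω ⟪G a, h⟫` for
every direction `a` and every `h ∈ L²(Ω; E)`** (weak convergence in `L²(Ω; E)` of `G_{κ k} a`);
the tested form `∫∫ φ ⟪G_{κ k} v, c⟫ → ∫∫ φ ⟪G v, c⟫`; and `∫_Ω ψ |G|² ≤ lim inf_k ∫_Ω ψ |G_{κ k}|²`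
for every continuous `ψ ≥ 0` compactly supported in `Ω` (Brezis 2011, Thm. 3.18, Prop. 3.5 (iii);
Evans, *PDE*, §5.2.1; the gradient side of the compactness of weak solutions of the
Navier–Stokes equations: Caffarelli–Kohn–Nirenberg 1982, §2; Lin 1998, Thm. 2.2; Bradshaw–Tsai
2019, §4.3 "in the weak topology on `L²(0,T;H¹(B₁))`"). [cite: BradshawTsai2019, §4.3 (proof of Thm 1.2)] [cite: CaffarelliKohnNirenberg1982, §2 (2.1), (2.5)] -/
theorem exists_hasWeakSpatialGradientOn_of_weakGradient_approx_L2 {Ω : Opens (ℝ × E)}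
    {u : ℝ → E → E} (hu : LocallyIntegrableOn (uncurry u) (Ω : Set (ℝ × E)) volume)
    {V : ℕ → ℝ → E → E} {Gn : ℕ → ℝ → E → E →L[ℝ] E}
    (hGw : ∀ n, HasWeakSpatialGradientOn Ω (V n) (Gn n))
    (hconv : ∀ K ⊆ (Ω : Set (ℝ × E)), IsCompact K →
      Tendsto (fun n => eLpNorm (fun z => uncurry (V n) z - uncurry u z) 1 (volume.restrict K))
        atTop (𝓝 0))
    {L : ℝ≥0∞} (hL : L ≠ ∞)
    (hbd : ∀ n, ∫⁻ z in (Ω : Set (ℝ × E)),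
      ENNReal.ofReal (frobeniusNormSq (Gn n z.1 z.2)) ≤ L) :
    ∃ (G : ℝ → E → E →L[ℝ] E) (κ : ℕ → ℕ), StrictMono κ ∧ HasWeakSpatialGradientOn Ω u G ∧
      MemLp (uncurry G) 2 (volume.restrict (Ω : Set (ℝ × E))) ∧
      ∫⁻ z in (Ω : Set (ℝ × E)), ENNReal.ofReal (frobeniusNormSq (G z.1 z.2)) ≤ L ∧
      (∀ (a : E) (h : ℝ × E → E), MemLp h 2 (volume.restrict (Ω : Set (ℝ × E))) →
        Tendsto (fun k => ∫ z in (Ω : Set (ℝ × E)), ⟪Gn (κ k) z.1 z.2 a, h z⟫) atTop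
          (𝓝 (∫ z in (Ω : Set (ℝ × E)), ⟪G z.1 z.2 a, h z⟫))) ∧
      (∀ φ : ℝ → E → ℝ, IsSpaceTimeTestOn Ω φ → ∀ v c : E,
        Tendsto (fun k => ∫ t, ∫ x, φ t x * ⟪Gn (κ k) t x v, c⟫) atTop
          (𝓝 (∫ t, ∫ x, φ t x * ⟪G t x v, c⟫))) ∧
      ∀ ψ : ℝ × E → ℝ, Continuous ψ → HasCompactSupport ψ → tsupport ψ ⊆ (Ω : Set (ℝ × E)) →
        (∀ z, 0 ≤ ψ z) →
        ∫ z in (Ω : Set (ℝ × E)), ψ z * frobeniusNormSq (G z.1 z.2) ≤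
          liminf (fun k => ∫ z in (Ω : Set (ℝ × E)), ψ z * frobeniusNormSq (Gn (κ k) z.1 z.2))
            atTop := by
  haveI : Fact ((1 : ℝ≥0∞) ≤ 2) := ⟨one_le_two⟩
  haveI : Fact ((2 : ℝ≥0∞) ≠ ∞) := ⟨ENNReal.ofNat_ne_top⟩
  have hΩm : MeasurableSet (Ω : Set (ℝ × E)) := Ω.isOpen.measurableSet
  have hVli : ∀ n, LocallyIntegrableOn (uncurry (V n)) (Ω : Set (ℝ × E)) volume :=
    fun n => (hGw n).locallyIntegrableOn
  have hGli : ∀ n, LocallyIntegrableOn (uncurry (Gn n)) (Ω : Set (ℝ × E)) volume :=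
    fun n => (hGw n).locallyIntegrableOn_grad
  -- ## the gradient tuples as a bounded sequence in `L²(Ω; E^d)`
  have hgm : ∀ n, AEStronglyMeasurable (fun z : ℝ × E =>
      (WithLp.toLp 2 fun i => Gn n z.1 z.2 (stdOrthonormalBasis ℝ E i) : GradTuple E))
      (volume.restrict (Ω : Set (ℝ × E))) := fun n =>
    continuous_toLp_apply_basis.comp_aestronglyMeasurable (hGli n).aestronglyMeasurable
  have hg2 : ∀ n, eLpNorm (fun z : ℝ × E =>
      (WithLp.toLp 2 fun i => Gn n z.1 z.2 (stdOrthonormalBasis ℝ E i) : GradTuple E)) 2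
      (volume.restrict (Ω : Set (ℝ × E))) ^ 2 ≤ L := fun n => by
    rw [MollifiedLimits.eLpNorm_two_pow_two]
    simp_rw [enorm_toLp_apply_basis_sq]
    exact hbd n
  have hgL : ∀ n, MemLp (fun z : ℝ × E =>
      (WithLp.toLp 2 fun i => Gn n z.1 z.2 (stdOrthonormalBasis ℝ E i) : GradTuple E)) 2
      (volume.restrict (Ω : Set (ℝ × E))) := fun n => by
    refine ⟨hgm n, ?_⟩
    have h1 := (hg2 n).trans_lt hL.lt_top
    by_contra htop
    rw [not_lt, top_le_iff] at htop
    rw [htop, ENNReal.top_pow two_ne_zero] at h1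
    exact lt_irrefl _ h1
  set w : ℕ → Lp (GradTuple E) 2 (volume.restrict (Ω : Set (ℝ × E))) :=
    fun n => (hgL n).toLp _ with hw
  have hLhalf : L ^ (1 / 2 : ℝ) ≠ ∞ := ENNReal.rpow_ne_top_of_nonneg (by norm_num) hL
  have hwM : ∀ n, ‖w n‖ ≤ (L ^ (1 / 2 : ℝ)).toReal := fun n => by
    rw [hw, Lp.norm_toLp]
    refine ENNReal.toReal_mono hLhalf ?_
    have h1 : eLpNorm (fun z : ℝ × E =>
        (WithLp.toLp 2 fun i => Gn n z.1 z.2 (stdOrthonormalBasis ℝ E i) : GradTuple E)) 2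
        (volume.restrict (Ω : Set (ℝ × E))) = (eLpNorm (fun z : ℝ × E =>
        (WithLp.toLp 2 fun i => Gn n z.1 z.2 (stdOrthonormalBasis ℝ E i) : GradTuple E)) 2
        (volume.restrict (Ω : Set (ℝ × E))) ^ 2) ^ (1 / 2 : ℝ) := by
      rw [← ENNReal.rpow_natCast, ← ENNReal.rpow_mul]; norm_num
    rw [h1]
    exact ENNReal.rpow_le_rpow (hg2 n) (by norm_num)
  -- ## weak limit along a subsequence
  obtain ⟨κ, hκ, wl, hwlM, hweak⟩ :=
    FunctionSpaces.exists_strictMono_tendsto_inner_of_norm_le hwM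
  have hglL : MemLp (wl : ℝ × E → GradTuple E) 2 (volume.restrict (Ω : Set (ℝ × E))) := Lp.memLp wl
  have hglto : hglL.toLp (wl : ℝ × E → GradTuple E) = wl := Lp.toLp_coeFn wl (Lp.memLp wl)
  -- the limit as an operator field
  set G : ℝ → E → E →L[ℝ] E := fun t x =>
    tupleToCLM (fun _ : E => (wl : ℝ × E → GradTuple E) (t, x)) 0 with hGdef
  have hGunc : uncurry G = fun z => tupleToCLM (fun _ : E => (wl : ℝ × E → GradTuple E) z) 0 := by
    funext z; rfl
  have hGm : AEStronglyMeasurable (uncurry G) (volume.restrict (Ω : Set (ℝ × E))) := by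
    rw [hGunc]; exact continuous_tupleToCLM_const.comp_aestronglyMeasurable hglL.1
  have hGL : MemLp (uncurry G) 2 (volume.restrict (Ω : Set (ℝ × E))) := by
    rw [hGunc]
    exact MemLp.of_le_mul (c := (Module.finrank ℝ E : ℝ)) hglL
      (continuous_tupleToCLM_const.comp_aestronglyMeasurable hglL.1)
      (Eventually.of_forall fun z => norm_tupleToCLM_le (fun _ : E => (wl : ℝ × E → GradTuple E) z) 0)
  have hGli' : LocallyIntegrableOn (uncurry G) (Ω : Set (ℝ × E)) volume :=
    locallyIntegrableOn_of_memLp_restrict one_le_two hGL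
  have hfrobG : ∀ z : ℝ × E, ENNReal.ofReal (frobeniusNormSq (G z.1 z.2)) =
      ‖(wl : ℝ × E → GradTuple E) z‖ₑ ^ 2 := fun z => by
    change ENNReal.ofReal (frobeniusNormSq (tupleToCLM (fun _ : E =>
      (wl : ℝ × E → GradTuple E) z) 0)) = _
    rw [frobeniusNormSq_tupleToCLM, ← ofReal_norm, ENNReal.ofReal_pow (norm_nonneg _)]
  have hfrobG' : ∀ z : ℝ × E, frobeniusNormSq (G z.1 z.2) = ‖(wl : ℝ × E → GradTuple E) z‖ ^ 2 :=
    fun z => frobeniusNormSq_tupleToCLM _ _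
  have hfrobn : ∀ n (z : ℝ × E), frobeniusNormSq (Gn n z.1 z.2) =
      ‖(WithLp.toLp 2 fun i => Gn n z.1 z.2 (stdOrthonormalBasis ℝ E i) : GradTuple E)‖ ^ 2 :=
    fun n z => by
      rw [PiLp.norm_sq_eq_of_L2, frobeniusNormSq_eq_sum (stdOrthonormalBasis ℝ E)]
  -- ## the dissipation bound of the limit
  have hbound : ∫⁻ z in (Ω : Set (ℝ × E)), ENNReal.ofReal (frobeniusNormSq (G z.1 z.2)) ≤ L := by
    simp_rw [hfrobG]
    rw [← MollifiedLimits.eLpNorm_two_pow_two]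
    have h2 : eLpNorm (wl : ℝ × E → GradTuple E) 2 (volume.restrict (Ω : Set (ℝ × E))) =
        ENNReal.ofReal ‖wl‖ := by
      rw [← hglto, Lp.norm_toLp, ENNReal.ofReal_toReal hglL.eLpNorm_ne_top]
      exact eLpNorm_congr_ae hglL.coeFn_toLp
    rw [h2]
    calc ENNReal.ofReal ‖wl‖ ^ 2 ≤ ENNReal.ofReal ((L ^ (1 / 2 : ℝ)).toReal) ^ 2 := by
          gcongr
      _ = L := by
          rw [ENNReal.ofReal_toReal hLhalf, ← ENNReal.rpow_natCast, ← ENNReal.rpow_mul]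
          norm_num
  -- ## pairings with test tuples are the iterated integrals
  have hpair : ∀ (φ : ℝ → E → ℝ), IsSpaceTimeTestOn Ω φ → ∀ v c : E,
      ∃ ζ : Lp (GradTuple E) 2 (volume.restrict (Ω : Set (ℝ × E))),
        (∀ n, ⟪w n, ζ⟫ = ∫ t, ∫ x, φ t x * ⟪Gn n t x v, c⟫) ∧
        ⟪wl, ζ⟫ = ∫ t, ∫ x, φ t x * ⟪G t x v, c⟫ := by
    intro φ hφ v c
    have cφ : Continuous (uncurry φ) := hφ.contDiff.continuous
    have hKc : IsCompact (tsupport (uncurry φ)) := hφ.hasCompactSupport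
    have hKΩ : tsupport (uncurry φ) ⊆ (Ω : Set (ℝ × E)) := hφ.tsupport_subset
    have hφK : ∀ z ∉ tsupport (uncurry φ), φ z.1 z.2 = 0 := fun z hz =>
      show uncurry φ z = 0 from image_eq_zero_of_notMem_tsupport hz
    have cζ : Continuous fun z : ℝ × E => testTuple (φ z.1) v c z.2 :=
      continuous_testTuple_slice cφ v c
    have hζK : ∀ z ∉ tsupport (uncurry φ), testTuple (φ z.1) v c z.2 = 0 := fun z hz =>
      testTuple_slice_eq_zero (hφK z hz)
    have hζL : MemLp (fun z : ℝ × E => testTuple (φ z.1) v c z.2) 2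
        (volume.restrict (Ω : Set (ℝ × E))) :=
      (cζ.memLp_of_hasCompactSupport (HasCompactSupport.intro hKc hζK)).restrict _
    refine ⟨hζL.toLp _, fun n => ?_, ?_⟩
    · rw [hw, WeakGradientLimit.inner_toLp_toLp_eq_integral (hgL n) hζL]
      have i1 : Integrable (fun z : ℝ × E => φ z.1 z.2 * ⟪Gn n z.1 z.2 v, c⟫)
          (volume : Measure (ℝ × E)) :=
        integrable_mul_inner_apply_of_locallyIntegrableOn (hGli n) cφ hKc hKΩ hφK v c
      have e1 : ∫ z, ⟪(WithLp.toLp 2 fun i => Gn n z.1 z.2 (stdOrthonormalBasis ℝ E i) : GradTuple E),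
          testTuple (φ z.1) v c z.2⟫ ∂(volume.restrict (Ω : Set (ℝ × E))) =
          ∫ z in (Ω : Set (ℝ × E)), φ z.1 z.2 * ⟪Gn n z.1 z.2 v, c⟫ := by
        refine integral_congr_ae (Eventually.of_forall fun z => ?_)
        dsimp only
        rw [inner_testTuple_slice_eq, tupleToCLM_const_toLp_apply]
      rw [e1, setIntegral_eq_integral_of_forall_compl_eq_zero fun z hz => by
        rw [hφK z (fun h => hz (hKΩ h)), zero_mul], Measure.volume_eq_prod,
        integral_prod _ (by simpa [Measure.volume_eq_prod] using i1)]
    · rw [← hglto, WeakGradientLimit.inner_toLp_toLp_eq_integral hglL hζL]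
      have i1 : Integrable (fun z : ℝ × E => φ z.1 z.2 * ⟪G z.1 z.2 v, c⟫)
          (volume : Measure (ℝ × E)) :=
        integrable_mul_inner_apply_of_locallyIntegrableOn hGli' cφ hKc hKΩ hφK v c
      have e1 : ∫ z, ⟪(wl : ℝ × E → GradTuple E) z, testTuple (φ z.1) v c z.2⟫
          ∂(volume.restrict (Ω : Set (ℝ × E))) =
          ∫ z in (Ω : Set (ℝ × E)), φ z.1 z.2 * ⟪G z.1 z.2 v, c⟫ :=
        integral_congr_ae (Eventually.of_forall fun z => inner_testTuple_slice_eq _ φ v c z)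
      rw [e1, setIntegral_eq_integral_of_forall_compl_eq_zero fun z hz => by
        rw [hφK z (fun h => hz (hKΩ h)), zero_mul], Measure.volume_eq_prod,
        integral_prod _ (by simpa [Measure.volume_eq_prod] using i1)]
  -- ## weak convergence of the gradients tested with test functions
  have hBall : ∀ (φ : ℝ → E → ℝ), IsSpaceTimeTestOn Ω φ → ∀ v c : E,
      Tendsto (fun k => ∫ t, ∫ x, φ t x * ⟪Gn (κ k) t x v, c⟫) atTop
        (𝓝 (∫ t, ∫ x, φ t x * ⟪G t x v, c⟫)) := by
    intro φ hφ v c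
    obtain ⟨ζ, hζn, hζl⟩ := hpair φ hφ v c
    have h := hweak ζ
    simp_rw [hζn, hζl] at h
    exact h
  -- ## full weak `L²` convergence of the gradients in every direction
  have hWeakL2 : ∀ (a : E) (h : ℝ × E → E), MemLp h 2 (volume.restrict (Ω : Set (ℝ × E))) →
      Tendsto (fun k => ∫ z in (Ω : Set (ℝ × E)), ⟪Gn (κ k) z.1 z.2 a, h z⟫) atTop
        (𝓝 (∫ z in (Ω : Set (ℝ × E)), ⟪G z.1 z.2 a, h z⟫)) := by
    intro a h hh
    have hζL : MemLp (fun z : ℝ × E =>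
        (WithLp.toLp 2 fun i => ⟪stdOrthonormalBasis ℝ E i, a⟫ • h z : GradTuple E)) 2
        (volume.restrict (Ω : Set (ℝ × E))) := memLp_dirTuple a hh
    have e1 : ∀ n, ⟪w n, hζL.toLp _⟫ = ∫ z in (Ω : Set (ℝ × E)), ⟪Gn n z.1 z.2 a, h z⟫ := by
      intro n
      rw [hw, WeakGradientLimit.inner_toLp_toLp_eq_integral (hgL n) hζL]
      refine integral_congr_ae (Eventually.of_forall fun z => ?_)
      exact (inner_apply_eq_inner_toLp_basis (Gn n z.1 z.2) a (h z)).symm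
    have e2 : ⟪wl, hζL.toLp _⟫ = ∫ z in (Ω : Set (ℝ × E)), ⟪G z.1 z.2 a, h z⟫ := by
      rw [← hglto, WeakGradientLimit.inner_toLp_toLp_eq_integral hglL hζL]
      refine integral_congr_ae (Eventually.of_forall fun z => ?_)
      exact (inner_tupleToCLM_const_apply_eq ((wl : ℝ × E → GradTuple E) z) a (h z)).symm
    have hk := hweak (hζL.toLp _)
    simp_rw [e1, e2] at hk
    exact hk
  refine ⟨G, κ, hκ, ⟨hu, hGli', fun φ hφ v c => ?_⟩, hGL, hbound, hWeakL2, hBall, ?_⟩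
  · -- ## the integration-by-parts identity in the limit
    have cφ : Continuous (uncurry φ) := hφ.contDiff.continuous
    have hKc : IsCompact (tsupport (uncurry φ)) := hφ.hasCompactSupport
    have hKΩ : tsupport (uncurry φ) ⊆ (Ω : Set (ℝ × E)) := hφ.tsupport_subset
    have hKm : MeasurableSet (tsupport (uncurry φ)) := hKc.measurableSet
    -- the weight `θ = ∂ᵥφ`
    have hθeq : ∀ z : ℝ × E, fderiv ℝ (φ z.1) z.2 v = fderiv ℝ (uncurry φ) z (0, v) := fun z =>
      fderiv_slice_apply (H := uncurry φ) ((hφ.contDiff.differentiable (by simp)) _) v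
    have cθ : Continuous fun z : ℝ × E => fderiv ℝ (φ z.1) z.2 v := by
      have : (fun z : ℝ × E => fderiv ℝ (φ z.1) z.2 v) = fun z => fderiv ℝ (uncurry φ) z (0, v) :=
        funext hθeq
      rw [this]
      exact (hφ.contDiff.continuous_fderiv (by simp)).clm_apply continuous_const
    have hθK : ∀ z ∉ tsupport (uncurry φ), fderiv ℝ (φ z.1) z.2 v = 0 := fun z hz => by
      -- slices of the space–time support: `z.2 ∉ tsupport (φ z.1 ·)`
      have hsub : tsupport (φ z.1) ⊆ Prod.mk z.1 ⁻¹' tsupport (uncurry φ) :=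
        closure_minimal (fun y hy => subset_tsupport _ (show uncurry φ (z.1, y) ≠ 0 from hy))
          ((isClosed_tsupport _).preimage (Continuous.prodMk_right z.1))
      have hz2 : z.2 ∉ tsupport (φ z.1) := fun h => hz (hsub h)
      rw [fderiv_of_notMem_tsupport (𝕜 := ℝ) hz2]
      rfl
    obtain ⟨Cθ, hCθ⟩ := cθ.bounded_above_of_compact_support (HasCompactSupport.intro hKc hθK)
    -- (1) the identities for the approximants
    have hIBP : ∀ n, ∫ t, ∫ x, fderiv ℝ (φ t) x v * ⟪V n t x, c⟫ =
        -∫ t, ∫ x, φ t x * ⟪Gn n t x v, c⟫ := fun n =>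
      (hGw n).integral_fderiv_mul_inner_eq φ hφ v c
    -- (2) convergence of the field side
    have hA : Tendsto (fun n => ∫ t, ∫ x, fderiv ℝ (φ t) x v * ⟪V n t x, c⟫) atTop
        (𝓝 (∫ t, ∫ x, fderiv ℝ (φ t) x v * ⟪u t x, c⟫)) := by
      have iAn : ∀ n, Integrable (fun z : ℝ × E => fderiv ℝ (φ z.1) z.2 v * ⟪V n z.1 z.2, c⟫)
          (volume : Measure (ℝ × E)) := fun n =>
        integrable_mul_inner_of_locallyIntegrableOn (hVli n) cθ hKc hKΩ hθK c
      have iA : Integrable (fun z : ℝ × E => fderiv ℝ (φ z.1) z.2 v * ⟪u z.1 z.2, c⟫)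
          (volume : Measure (ℝ × E)) :=
        integrable_mul_inner_of_locallyIntegrableOn hu cθ hKc hKΩ hθK c
      have eAn : ∀ n, ∫ t, ∫ x, fderiv ℝ (φ t) x v * ⟪V n t x, c⟫ =
          ∫ z in tsupport (uncurry φ), fderiv ℝ (φ z.1) z.2 v * ⟪V n z.1 z.2, c⟫ := fun n => by
        have h1 : ∫ z, fderiv ℝ (φ z.1) z.2 v * ⟪V n z.1 z.2, c⟫ ∂(volume : Measure (ℝ × E)) =
            ∫ t, ∫ x, fderiv ℝ (φ t) x v * ⟪V n t x, c⟫ := by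
          rw [Measure.volume_eq_prod, integral_prod _ (by simpa [Measure.volume_eq_prod] using iAn n)]
        rw [← h1, setIntegral_eq_integral_of_forall_compl_eq_zero fun z hz => by
          rw [hθK z hz, zero_mul]]
      have eA : ∫ t, ∫ x, fderiv ℝ (φ t) x v * ⟪u t x, c⟫ =
          ∫ z in tsupport (uncurry φ), fderiv ℝ (φ z.1) z.2 v * ⟪u z.1 z.2, c⟫ := by
        have h1 : ∫ z, fderiv ℝ (φ z.1) z.2 v * ⟪u z.1 z.2, c⟫ ∂(volume : Measure (ℝ × E)) =
            ∫ t, ∫ x, fderiv ℝ (φ t) x v * ⟪u t x, c⟫ := by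
          rw [Measure.volume_eq_prod, integral_prod _ (by simpa [Measure.volume_eq_prod] using iA)]
        rw [← h1, setIntegral_eq_integral_of_forall_compl_eq_zero fun z hz => by
          rw [hθK z hz, zero_mul]]
      simp_rw [eAn, eA]
      have huK : IntegrableOn (uncurry u) (tsupport (uncurry φ)) volume :=
        hu.integrableOn_compact_subset hKΩ hKc
      have hVK : ∀ n, IntegrableOn (uncurry (V n)) (tsupport (uncurry φ)) volume := fun n =>
        (hVli n).integrableOn_compact_subset hKΩ hKc
      have hΦn : ∀ n, Integrable (fun z : ℝ × E => ⟪V n z.1 z.2, c⟫)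
          (volume.restrict (tsupport (uncurry φ))) := fun n => (hVK n).inner_const c
      have hΦ : Integrable (fun z : ℝ × E => ⟪u z.1 z.2, c⟫)
          (volume.restrict (tsupport (uncurry φ))) := huK.inner_const c
      have hL1 : Tendsto (fun n => eLpNorm ((fun z : ℝ × E => ⟪V n z.1 z.2, c⟫) -
          fun z : ℝ × E => ⟪u z.1 z.2, c⟫) 1 (volume.restrict (tsupport (uncurry φ)))) atTop (𝓝 0) := by
        have hb : ∀ n, eLpNorm ((fun z : ℝ × E => ⟪V n z.1 z.2, c⟫) -
            fun z : ℝ × E => ⟪u z.1 z.2, c⟫) 1 (volume.restrict (tsupport (uncurry φ))) ≤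
            ENNReal.ofReal ‖c‖ * eLpNorm (fun z => uncurry (V n) z - uncurry u z) 1
              (volume.restrict (tsupport (uncurry φ))) := by
          intro n
          refine eLpNorm_le_mul_eLpNorm_of_ae_le_mul (Eventually.of_forall fun z => ?_) 1
          simp only [Pi.sub_apply]
          rw [← inner_sub_left]
          calc ‖⟪V n z.1 z.2 - u z.1 z.2, c⟫‖ ≤ ‖V n z.1 z.2 - u z.1 z.2‖ * ‖c‖ :=
                norm_inner_le_norm _ _
            _ = ‖c‖ * ‖uncurry (V n) z - uncurry u z‖ := by
                rw [mul_comm]; rfl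
        have hlim : Tendsto (fun n => ENNReal.ofReal ‖c‖ *
            eLpNorm (fun z => uncurry (V n) z - uncurry u z) 1
              (volume.restrict (tsupport (uncurry φ)))) atTop (𝓝 0) := by
          have := ENNReal.Tendsto.const_mul (hconv _ hKΩ hKc) (a := ENNReal.ofReal ‖c‖)
            (Or.inr ENNReal.ofReal_ne_top)
          simpa only [mul_zero] using this
        exact tendsto_of_tendsto_of_tendsto_of_le_of_le tendsto_const_nhds hlim
          (fun n => zero_le) hb
      have key := tendsto_setIntegral_mul_of_tendsto_eLpNorm_one
        (μ := volume.restrict (tsupport (uncurry φ)))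
        (cθ.aestronglyMeasurable) (Eventually.of_forall hCθ) hΦn hΦ hL1 univ
      simp only [Measure.restrict_univ] at key
      exact key
    -- (3) conclusion along the subsequence
    have hA' := hA.comp hκ.tendsto_atTop
    have hA'' : Tendsto (fun k => ∫ t, ∫ x, fderiv ℝ (φ t) x v * ⟪V (κ k) t x, c⟫) atTop
        (𝓝 (-∫ t, ∫ x, φ t x * ⟪G t x v, c⟫)) := by
      have : (fun k => ∫ t, ∫ x, fderiv ℝ (φ t) x v * ⟪V (κ k) t x, c⟫) =
          fun k => -∫ t, ∫ x, φ t x * ⟪Gn (κ k) t x v, c⟫ := funext fun k => hIBP (κ k)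
      rw [this]
      exact (hBall φ hφ v c).neg
    exact tendsto_nhds_unique hA' hA''
  · -- ## lower semicontinuity of the weighted dissipations
    intro ψ hψc hψs hψΩ hψ0
    obtain ⟨Cψ, hCψ⟩ := hψc.bounded_above_of_compact_support hψs
    -- the weight `ρ = √ψ` and the weighted classes
    have cρ : Continuous fun z => Real.sqrt (ψ z) := Real.continuous_sqrt.comp hψc
    have hρb : ∀ z, ‖Real.sqrt (ψ z)‖ ≤ Real.sqrt Cψ := fun z => by
      rw [Real.norm_eq_abs, abs_of_nonneg (Real.sqrt_nonneg _)]
      exact Real.sqrt_le_sqrt ((le_abs_self _).trans ((Real.norm_eq_abs _).symm.le.trans (hCψ z)))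
    have hρm : MemLp (fun z => Real.sqrt (ψ z)) ∞ (volume.restrict (Ω : Set (ℝ × E))) :=
      memLp_top_of_bound cρ.aestronglyMeasurable (Real.sqrt Cψ) (Eventually.of_forall hρb)
    have hρgn : ∀ n, MemLp (fun z : ℝ × E => Real.sqrt (ψ z) •
        (WithLp.toLp 2 fun i => Gn n z.1 z.2 (stdOrthonormalBasis ℝ E i) : GradTuple E)) 2
        (volume.restrict (Ω : Set (ℝ × E))) := fun n => (hgL n).smul hρm
    have hρgl : MemLp (fun z : ℝ × E => Real.sqrt (ψ z) • (wl : ℝ × E → GradTuple E) z) 2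
        (volume.restrict (Ω : Set (ℝ × E))) := hglL.smul hρm
    have hψgl : MemLp (fun z : ℝ × E => ψ z • (wl : ℝ × E → GradTuple E) z) 2
        (volume.restrict (Ω : Set (ℝ × E))) :=
      hglL.smul (memLp_top_of_bound hψc.aestronglyMeasurable Cψ (Eventually.of_forall hCψ))
    -- weak convergence of the weighted classes, tested against the weighted limit
    have hwk : ∀ z : Lp (GradTuple E) 2 (volume.restrict (Ω : Set (ℝ × E))),
        Tendsto (fun k => ⟪(hρgn (κ k)).toLp _, z⟫) atTop (𝓝 ⟪hρgl.toLp _, z⟫) := by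
      -- it suffices to test against `ρ gl`: reduce to `⟪g, ρ z'⟫` with `z' = ρ gl`? No: general `z`.
      intro z
      have hzL : MemLp (z : ℝ × E → GradTuple E) 2 (volume.restrict (Ω : Set (ℝ × E))) := Lp.memLp z
      have hρz : MemLp (fun y : ℝ × E => Real.sqrt (ψ y) • (z : ℝ × E → GradTuple E) y) 2
          (volume.restrict (Ω : Set (ℝ × E))) := hzL.smul hρm
      have e1 : ∀ n, ⟪(hρgn n).toLp _, z⟫ = ⟪w n, hρz.toLp _⟫ := by
        intro n
        rw [hw]
        simp only [MeasureTheory.L2.inner_def]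
        refine integral_congr_ae ?_
        filter_upwards [(hρgn n).coeFn_toLp, (hgL n).coeFn_toLp, hρz.coeFn_toLp] with y h1 h2 h3
        rw [h1, h2, h3, real_inner_smul_left, real_inner_smul_right]
      have e2 : ⟪hρgl.toLp _, z⟫ = ⟪wl, hρz.toLp _⟫ := by
        simp only [MeasureTheory.L2.inner_def]
        refine integral_congr_ae ?_
        filter_upwards [hρgl.coeFn_toLp, hρz.coeFn_toLp] with y h1 h3
        rw [h1, h3, real_inner_smul_left, real_inner_smul_right]
      simp_rw [e1, e2]
      exact hweak _
    -- identify the norms with the weighted dissipations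
    have hnorm_n : ∀ n, ‖(hρgn n).toLp _‖ ^ 2 =
        ∫ z in (Ω : Set (ℝ × E)), ψ z * frobeniusNormSq (Gn n z.1 z.2) := by
      intro n
      rw [WeakGradientLimit.norm_toLp_sq_eq_integral (hρgn n)]
      refine integral_congr_ae (Eventually.of_forall fun z => ?_)
      dsimp only
      rw [norm_smul, mul_pow, Real.norm_eq_abs, sq_abs, Real.sq_sqrt (hψ0 z), hfrobn]
    have hnorm_l : ‖hρgl.toLp _‖ ^ 2 = ∫ z in (Ω : Set (ℝ × E)), ψ z * frobeniusNormSq (G z.1 z.2) := by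
      rw [WeakGradientLimit.norm_toLp_sq_eq_integral hρgl]
      refine integral_congr_ae (Eventually.of_forall fun z => ?_)
      dsimp only
      rw [norm_smul, mul_pow, Real.norm_eq_abs, sq_abs, Real.sq_sqrt (hψ0 z), hfrobG']
    -- a uniform bound of the weighted classes
    have hbddM : ∀ k, ‖(hρgn (κ k)).toLp _‖ ≤ Real.sqrt Cψ * (L ^ (1 / 2 : ℝ)).toReal := by
      intro k
      rw [Lp.norm_toLp]
      have h1 : eLpNorm (fun z : ℝ × E => Real.sqrt (ψ z) •
          (WithLp.toLp 2 fun i => Gn (κ k) z.1 z.2 (stdOrthonormalBasis ℝ E i) : GradTuple E)) 2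
          (volume.restrict (Ω : Set (ℝ × E))) ≤ ENNReal.ofReal (Real.sqrt Cψ) *
          eLpNorm (fun z : ℝ × E =>
            (WithLp.toLp 2 fun i => Gn (κ k) z.1 z.2 (stdOrthonormalBasis ℝ E i) : GradTuple E)) 2
            (volume.restrict (Ω : Set (ℝ × E))) := by
        refine eLpNorm_le_mul_eLpNorm_of_ae_le_mul (Eventually.of_forall fun z => ?_) 2
        rw [norm_smul]
        exact mul_le_mul_of_nonneg_right (hρb z) (norm_nonneg _)
      have h2 : (ENNReal.ofReal (Real.sqrt Cψ) * eLpNorm (fun z : ℝ × E =>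
            (WithLp.toLp 2 fun i => Gn (κ k) z.1 z.2 (stdOrthonormalBasis ℝ E i) : GradTuple E)) 2
            (volume.restrict (Ω : Set (ℝ × E)))).toReal ≤ Real.sqrt Cψ * (L ^ (1 / 2 : ℝ)).toReal := by
        rw [ENNReal.toReal_mul, ENNReal.toReal_ofReal (Real.sqrt_nonneg _)]
        refine mul_le_mul_of_nonneg_left ?_ (Real.sqrt_nonneg _)
        have := hwM (κ k)
        rwa [hw, Lp.norm_toLp] at this
      exact (ENNReal.toReal_mono (ENNReal.mul_ne_top ENNReal.ofReal_ne_top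
        (hgL (κ k)).eLpNorm_ne_top) h1).trans h2
    have hsq := WeakGradientLimit.norm_sq_le_liminf_of_tendsto_inner
      (v := fun k => (hρgn (κ k)).toLp _) hwk hbddM
    rw [← hnorm_l]
    simp_rw [hnorm_n] at hsq
    exact hsq

end Extraction

end Literature.Analysis.FluidPDE
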